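import Mathlib
import HarnessLib
import Literature.Combinatorics.Additive.HamidouneRodsethRuns

/-!
# Hamidoune–Rødseth's inverse theorem mod `p`, II: Lemmas 4 and 5

Topic `Literature/Combinatorics/Additive`.  Sequel of `HamidouneRodsethRuns.lean`; source
Y. O. Hamidoune, Ø. J. Rødseth, *An inverse theorem mod p*, Acta Arith. 92 (2000) 251–262, §4
(pp. 255–257 of the printed paper, read from the publisher's open copy `paper:url-91a40b2366eb`).

Throughout, `C(A, B)` abbreviates the CONCLUSION of the inverse theorem, "`A` and `B` are almost
progressions with the same difference": `∃ e a b, e ≠ 0 ∧ A ⊆ apFinset a e (|A| + 1) ∧ B ⊆ apFinset b e (|B| + 1)`,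
and hypothesis (6) of the paper is `|A + B| = |A| + |B| ≤ p − 4`.

* `common_of_isAP_add` — Lemma 3 applied on both sides: if `A + B` is an `e`-progression and
  `|A + B| ≤ |A| + |B| ≤ p − 3` then `C(A, B)`.
* **Lemma 4** (p. 255), in the form "`A` the union of two `d`-runs, `|A| ≥ 3`, (6) ⇒ (i) `B` is a double
  `d`-progression, or (ii) `C(A, B)`, or (iii) `|A| = 3`, `B` has three `d`-components and
  `A + B = {a, a + d} + B` for the two-element run `{a, a + d}` of `A`": `runs_le_two_or_common_of_two_runs`
  (with the two printed cases `|A₁| ≥ 2` / `|A₁| = 1` as `common_of_two_long_runs` / `…_of_singleton_run`).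
* **Lemma 5** (p. 256) for `|A| ≥ 4`: "`|A|, |B| ≥ 3`, `7 ≤ |A + B| = |A| + |B| ≤ p − 4`, `A` an almost
  progression ⇒ `C(A, B)`": `common_of_subset_apFinset`.  The printed proof treats case (i) of Lemma 4 via
  the component structure (8) of `A + B` and case (iii) (`|A| = 3`) via component lengths; here case (i)
  is done exactly as printed (sub-case `|B₁| ≥ 2`: the two runs `A + B₁`, `A + B₂` of `A + B` would have
  to meet; sub-case `|B₁| = 1`: three components are impossible by counting, two components give
  `|{0,d} + A + B| = |{0,d} + A| + |B|` and Lemma 1 applies to the progression `{0,d} + A`), and case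
  (iii) does not arise for `|A| ≥ 4` — the statement for `|A| = 3` is part of the `min(|A|,|B|) = 3` layer
  of the theorem, typed separately.

All statements are for a general step `d ≠ 0` (the paper normalises `d = 1` by an affine map, p. 252).
Census-silent (pub-omega, seat stpp-1 gen 31).
-/

namespace Literature.Combinatorics.Additive

open Finset
open scoped Pointwise

namespace HamidouneRodseth

variable {p : ℕ} [hp : Fact p.Prime]

/-! ## Small tools -/

/-- `apFinset a d 2 = {a, a + d}`. [cite: Nathanson1996, §2.5 (arithmetic progressions in ℤ/pℤ)] -/
theorem apFinset_two (a d : ZMod p) : apFinset a d 2 = {a, a + d} := by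
  ext x
  simp only [mem_apFinset, mem_insert, mem_singleton]
  constructor
  · rintro ⟨i, hi, rfl⟩
    interval_cases i <;> simp
  · rintro (rfl | rfl)
    · exact ⟨0, by omega, by simp⟩
    · exact ⟨1, by omega, by simp⟩

/-- `apFinset a d 1 + X = a + X`... as a translate. [cite: Nathanson1996, §2.5 (arithmetic progressions in ℤ/pℤ)] -/
theorem add_singleton_eq_vadd (X : Finset (ZMod p)) (β : ZMod p) : X + {β} = β +ᵥ X := by
  rw [add_comm, singleton_add]

/-- Two runs whose union has as many elements as the lengths add up to are disjoint.
[cite: Nathanson1996, §2.5 (arithmetic progressions in ℤ/pℤ)] -/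
theorem disjoint_of_card_union_eq {a₁ a₂ d : ZMod p} (hd : d ≠ 0) {n₁ n₂ : ℕ} (hn₁ : n₁ ≤ p) (hn₂ : n₂ ≤ p)
    (h : n₁ + n₂ ≤ #(apFinset a₁ d n₁ ∪ apFinset a₂ d n₂)) :
    Disjoint (apFinset a₁ d n₁) (apFinset a₂ d n₂) := by
  rw [disjoint_iff_inter_eq_empty, ← card_eq_zero]
  have := card_union_add_card_inter (apFinset a₁ d n₁) (apFinset a₂ d n₂)
  rw [card_apFinset hd hn₁, card_apFinset hd hn₂] at this
  omega

/-- **Vosper, sum form**: a critical pair of sets with at least two elements each and `|X + Y| ≤ p − 2`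
has a progression as its sumset. [cite: Vosper1956, main theorem; Nathanson1996, Thm 2.7 (§2.5)] -/
theorem exists_isAP_add_of_critical {X Y : Finset (ZMod p)} (h2X : 2 ≤ #X) (h2Y : 2 ≤ #Y)
    (hcrit : #(X + Y) + 1 = #X + #Y) (hsmall : #(X + Y) + 2 ≤ p) : ∃ e : ZMod p, e ≠ 0 ∧ IsAP (X + Y) e := by
  obtain ⟨e, he, hX, hY⟩ := vosper_inverse h2X h2Y (by omega) (by omega)
  exact ⟨e, he, hX.add hY hcrit⟩

/-- **Lemma 3 on both sides**: if `A + B` is an `e`-progression (`e ≠ 0`) and `|A + B| ≤ |A| + |B| ≤ p − 3`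
then `A` and `B` are almost `e`-progressions. [cite: HamidouneRodseth2000, §2 Lemma 3 (pp. 253–254)] -/
theorem common_of_isAP_add {A B : Finset (ZMod p)} {e : ZMod p} (he : e ≠ 0) (hA : A.Nonempty)
    (hB : B.Nonempty) (hAP : IsAP (A + B) e) (hAB : #(A + B) ≤ #A + #B) (hp3 : #A + #B + 3 ≤ p) :
    ∃ a b : ZMod p, A ⊆ apFinset a e (#A + 1) ∧ B ⊆ apFinset b e (#B + 1) := by
  obtain ⟨a, ha⟩ := subset_apFinset_of_isAP_add he hA hB hAP hAB hp3
  have hAP' : IsAP (B + A) e := by rwa [add_comm]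
  obtain ⟨b, hb⟩ := subset_apFinset_of_isAP_add he hB hA hAP' (by rw [add_comm]; omega) (by omega)
  exact ⟨a, b, ha, hb⟩

/-! ## Lemma 4 -/

/-- **Lemma 4, Case 1 (`|A₁|, |A₂| ≥ 2`)** (p. 255): `A = A₁ ∪ A₂` two disjoint `d`-runs of lengths
`n₁, n₂ ≥ 2`, `|A + B| = |A| + |B| ≤ p − 4`, and `B` has at least three `d`-components.  Then
`A = {0,d} + A′` with `|A′| = |A| − 2`, Cauchy–Davenport gives `|A′ + ({0,d} + B)| = |A′| + |{0,d} + B| − 1`,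
Vosper makes both `e`-progressions, so `A + B` is an `e`-progression and Lemma 3 gives `C(A, B)`.
[cite: HamidouneRodseth2000, §4 Lemma 4, Case 1 (pp. 255–256)] -/
theorem common_of_two_long_runs {A B : Finset (ZMod p)} {d a₁ a₂ : ZMod p} (hd : d ≠ 0) {n₁ n₂ : ℕ}
    (hA : A = apFinset a₁ d n₁ ∪ apFinset a₂ d n₂) (hn₁ : 2 ≤ n₁) (hn₂ : 2 ≤ n₂) (hcardA : n₁ + n₂ = #A)
    (hB : B.Nonempty) (hAB : #(A + B) = #A + #B) (hp4 : #(A + B) + 4 ≤ p) (hk : 3 ≤ #((d +ᵥ B) \ B)) :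
    ∃ e a b : ZMod p, e ≠ 0 ∧ A ⊆ apFinset a e (#A + 1) ∧ B ⊆ apFinset b e (#B + 1) := by
  set T : Finset (ZMod p) := {0, d} with hT
  have hBpos := hB.card_pos
  have hn₁p : n₁ ≤ p := by omega
  have hn₂p : n₂ ≤ p := by omega
  have hdisj : Disjoint (apFinset a₁ d n₁) (apFinset a₂ d n₂) :=
    disjoint_of_card_union_eq hd hn₁p hn₂p (by rw [← hA]; omega)
  set A' : Finset (ZMod p) := apFinset a₁ d (n₁ - 1) ∪ apFinset a₂ d (n₂ - 1) with hA'
  have hA'T : A' + T = A := by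
    rw [hA', union_add, hT, apFinset_add_pair_zero (by omega : 1 ≤ n₁ - 1),
      apFinset_add_pair_zero (by omega : 1 ≤ n₂ - 1), Nat.sub_add_cancel (by omega : 1 ≤ n₁),
      Nat.sub_add_cancel (by omega : 1 ≤ n₂), hA]
  have hdisj' : Disjoint (apFinset a₁ d (n₁ - 1)) (apFinset a₂ d (n₂ - 1)) :=
    hdisj.mono (Isoperimetric.apFinset_mono a₁ d (by omega)) (Isoperimetric.apFinset_mono a₂ d (by omega))
  have hcardA' : #A' = #A - 2 := by
    rw [hA', card_union_of_disjoint hdisj', card_apFinset hd (by omega), card_apFinset hd (by omega)]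
    omega
  have hTB : #(T + B) = #B + #((d +ᵥ B) \ B) := by
    rw [add_comm]; exact Isoperimetric.card_add_pair_zero_eq B d
  have hsum : A + B = A' + (T + B) := by rw [← add_assoc, hA'T]
  have hABu : A + B ≠ univ := ne_univ_of_card_lt (by omega)
  have hA'ne : A'.Nonempty := card_pos.1 (by omega)
  have hTBne : (T + B).Nonempty := Nonempty.add (by simp [hT]) hB
  have hcd := Vosper.cauchy_davenport_of_ne_univ hA'ne hTBne (hsum ▸ hABu)
  rw [← hsum] at hcd
  -- so `k = 3` and the pair `(A′, T + B)` is critical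
  have hcrit : #(A' + (T + B)) + 1 = #A' + #(T + B) := by rw [← hsum]; omega
  obtain ⟨e, he, hAPe⟩ := exists_isAP_add_of_critical (by omega) (by omega) hcrit (by rw [← hsum]; omega)
  rw [← hsum] at hAPe
  obtain ⟨a, b, ha, hb⟩ := common_of_isAP_add he (card_pos.1 (by omega)) hB hAPe hAB.le (by omega)
  exact ⟨e, a, b, he, ha, hb⟩

/-- **Lemma 4, Case 2 (`|A₁| = 1`)** (p. 256): `A = {a′} ∪ A₂` with `A₂` a `d`-run of length `|A| − 1 ≥ 2`,
`|A + B| = |A| + |B| ≤ p − 4`, and `B` has at least three `d`-components.  Then `B` has EXACTLY three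
`d`-components, `A + B = A₂ + B`, and: if `|A| ≥ 4`, Vosper and Lemma 3 give `C(A, B)`; if `|A| = 3`, then
`A + B = {a, a + d} + B` where `A₂ = {a, a + d}` (case (iii) of the printed lemma).
[cite: HamidouneRodseth2000, §4 Lemma 4, Case 2 (p. 256)] -/
theorem common_or_three_of_singleton_run {A B : Finset (ZMod p)} {d a' a : ZMod p} (hd : d ≠ 0) {n : ℕ}
    (hA : A = {a'} ∪ apFinset a d n) (hn : n + 1 = #A) (hA3 : 3 ≤ #A)
    (hB : B.Nonempty) (hAB : #(A + B) = #A + #B) (hp4 : #(A + B) + 4 ≤ p) (hk : 3 ≤ #((d +ᵥ B) \ B)) :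
    (∃ e a b : ZMod p, e ≠ 0 ∧ A ⊆ apFinset a e (#A + 1) ∧ B ⊆ apFinset b e (#B + 1)) ∨
      (#A = 3 ∧ #((d +ᵥ B) \ B) = 3 ∧ A = {a', a, a + d} ∧ A + B = {a, a + d} + B) := by
  set T : Finset (ZMod p) := {0, d} with hT
  have hBpos := hB.card_pos
  set A₂ := apFinset a d n with hA₂
  set A₂' := apFinset a d (n - 1) with hA₂'
  have hA₂'T : A₂' + T = A₂ := by
    rw [hA₂', hT, apFinset_add_pair_zero (by omega : 1 ≤ n - 1), Nat.sub_add_cancel (by omega : 1 ≤ n)]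
  have hcardA₂' : #A₂' = n - 1 := card_apFinset hd (by omega)
  have hTB : #(T + B) = #B + #((d +ᵥ B) \ B) := by
    rw [add_comm]; exact Isoperimetric.card_add_pair_zero_eq B d
  have hA₂A : A₂ ⊆ A := by rw [hA]; exact subset_union_right
  have hsub : A₂' + (T + B) ⊆ A + B := by
    rw [← add_assoc, hA₂'T]; exact add_subset_add_right hA₂A
  have hABu : A + B ≠ univ := ne_univ_of_card_lt (by omega)
  have hA₂'ne : A₂'.Nonempty := card_pos.1 (by omega)
  have hTBne : (T + B).Nonempty := Nonempty.add (by simp [hT]) hB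
  have hne' : A₂' + (T + B) ≠ univ := fun h => hABu (eq_univ_of_subset hsub h)
  have hcd := Vosper.cauchy_davenport_of_ne_univ hA₂'ne hTBne hne'
  have hle := card_le_card hsub
  -- `k = 3`, `A₂ + B = A + B`, and the pair `(A₂′, T + B)` is critical
  have hk3 : #((d +ᵥ B) \ B) = 3 := by omega
  have heq : A₂' + (T + B) = A + B := eq_of_subset_of_card_le hsub (by omega)
  have hcrit : #(A₂' + (T + B)) + 1 = #A₂' + #(T + B) := by omega
  by_cases hA4 : 4 ≤ #A
  · left
    obtain ⟨e, he, hAPe⟩ := exists_isAP_add_of_critical (by omega) (by omega) hcrit (by omega)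
    rw [heq] at hAPe
    obtain ⟨x, y, hx, hy⟩ := common_of_isAP_add he (card_pos.1 (by omega)) hB hAPe hAB.le (by omega)
    exact ⟨e, x, y, he, hx, hy⟩
  · right
    have hA3' : #A = 3 := by omega
    have hn2 : n = 2 := by omega
    refine ⟨hA3', hk3, ?_, ?_⟩
    · rw [hA, hA₂, hn2, apFinset_two, ← insert_eq]
    · rw [← heq, ← add_assoc, hA₂'T, hA₂, hn2, apFinset_two]

/-- **Lemma 4 of Hamidoune–Rødseth** (p. 255): "Suppose that `|A| ≥ 3`, and that
`|A + B| = |A| + |B| ≤ p − 4`.  Also assume that `A` is a double 1-progression.  Then one of the following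
holds. (i) `B` is a double 1-progression. (ii) `A` and `B` are almost-progressions with the same
difference. (iii) `|A| = 3`, `B` has three 1-components …" — for a general step `d ≠ 0`, with `A` given as
the union of two `d`-runs of lengths `n₁, n₂ ≥ 1`, `n₁ + n₂ = |A|` (a double `d`-progression which is not
a progression is of this form, `exists_two_components`), and with (iii) recorded as
`A + B = {a, a + d} + B` for the two-element run of `A`.
[cite: HamidouneRodseth2000, §4 Lemma 4 (pp. 255–256)] -/
theorem runs_le_two_or_common_of_two_runs {A B : Finset (ZMod p)} {d a₁ a₂ : ZMod p} (hd : d ≠ 0)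
    {n₁ n₂ : ℕ} (hA : A = apFinset a₁ d n₁ ∪ apFinset a₂ d n₂) (hn₁ : 1 ≤ n₁) (hn₂ : 1 ≤ n₂)
    (hcardA : n₁ + n₂ = #A) (hA3 : 3 ≤ #A) (hB : B.Nonempty) (hAB : #(A + B) = #A + #B)
    (hp4 : #(A + B) + 4 ≤ p) :
    #((d +ᵥ B) \ B) ≤ 2 ∨
      (∃ e a b : ZMod p, e ≠ 0 ∧ A ⊆ apFinset a e (#A + 1) ∧ B ⊆ apFinset b e (#B + 1)) ∨
      (#A = 3 ∧ #((d +ᵥ B) \ B) = 3 ∧ ∃ a' a : ZMod p, A = {a', a, a + d} ∧ A + B = {a, a + d} + B) := by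
  by_cases hk : #((d +ᵥ B) \ B) ≤ 2
  · exact Or.inl hk
  right
  push Not at hk
  rcases (show n₁ = 1 ∨ n₂ = 1 ∨ (2 ≤ n₁ ∧ 2 ≤ n₂) by omega) with h1 | h1 | ⟨h2, h2'⟩
  · subst h1
    rw [apFinset_one] at hA
    rcases common_or_three_of_singleton_run hd hA (by omega) hA3 hB hAB hp4 hk with h | ⟨h3, hk3, hA', hAB'⟩
    · exact Or.inl h
    · exact Or.inr ⟨h3, hk3, a₁, a₂, hA', hAB'⟩
  · subst h1
    rw [apFinset_one, union_comm] at hA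
    rcases common_or_three_of_singleton_run hd hA (by omega) hA3 hB hAB hp4 hk with h | ⟨h3, hk3, hA', hAB'⟩
    · exact Or.inl h
    · exact Or.inr ⟨h3, hk3, a₂, a₁, hA', hAB'⟩
  · exact Or.inl (common_of_two_long_runs hd hA h2 h2' hcardA hB hAB hp4 hk)

/-! ## Lemma 5 -/

/-- The run decomposition of an almost progression with an interior hole: if
`A ∪ {q} = {α, …, α + n d}` with `q = α + i d ∉ A`, then `A = {α, …, α + (i−1)d} ∪ {α + (i+1)d, …, α + n d}`.
[cite: HamidouneRodseth2000, §1 (p. 251: almost progressions)] -/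
theorem eq_union_of_insert_eq_apFinset {A : Finset (ZMod p)} {α d q : ZMod p} (hd : d ≠ 0) {n i : ℕ}
    (hnp : n + 1 ≤ p) (hins : insert q A = apFinset α d (n + 1)) (hqA : q ∉ A) (hq : α + i • d = q)
    (hi : i < n + 1) : A = apFinset α d i ∪ apFinset (α + (i + 1) • d) d (n - i) := by
  have hsplit : apFinset α d (n + 1) = apFinset α d i ∪ ({q} ∪ apFinset (α + (i + 1) • d) d (n - i)) := by
    rw [show n + 1 = i + (1 + (n - i)) by omega, apFinset_add_eq_union, apFinset_add_eq_union,
      apFinset_one, one_nsmul, add_assoc, ← succ_nsmul, hq]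
  have hq1 : q ∉ apFinset α d i := by rw [← hq]; exact add_nsmul_notMem_apFinset hd (by omega)
  have hq2 : q ∉ apFinset (α + (i + 1) • d) d (n - i) := by
    have : q = α + (i + 1) • d - d := by rw [← hq, succ_nsmul]; abel
    rw [this]; exact sub_notMem_apFinset hd (by omega)
  ext x
  constructor
  · intro hx
    have hxP : x ∈ insert q A := mem_insert_of_mem hx
    rw [hins, hsplit, mem_union, mem_union, mem_singleton] at hxP
    rw [mem_union]
    rcases hxP with h | rfl | h
    · exact Or.inl h
    · exact absurd hx hqA
    · exact Or.inr h
  · intro hx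
    rw [mem_union] at hx
    have hxP : x ∈ apFinset α d (n + 1) := by
      rw [hsplit, mem_union, mem_union]
      rcases hx with h | h
      · exact Or.inl h
      · exact Or.inr (Or.inr h)
    rw [← hins, mem_insert] at hxP
    rcases hxP with rfl | h
    · rcases hx with h | h
      · exact absurd h hq1
      · exact absurd h hq2
    · exact h

/-- The index of an interior hole is neither `0` nor `n`. [cite: HamidouneRodseth2000, §1 (p. 251: almost progressions)] -/
theorem hole_index_bounds {A : Finset (ZMod p)} {α d q : ZMod p} (hd : d ≠ 0) {n i : ℕ} (hnp : n + 1 < p)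
    (hAP : A ⊆ apFinset α d (n + 1)) (hq : α + i • d = q) (hi : i < n + 1) (hq1 : q - d ∈ A)
    (hq2 : q + d ∈ A) : 1 ≤ i ∧ i + 1 ≤ n := by
  constructor
  · rw [Nat.one_le_iff_ne_zero]
    rintro rfl
    rw [zero_nsmul, add_zero] at hq
    rw [← hq] at hq1
    exact sub_notMem_apFinset hd (by omega) (hAP hq1)
  · have hmem := hAP hq2
    rw [← hq, add_assoc, ← succ_nsmul] at hmem
    have := (add_nsmul_mem_apFinset_iff hd (by omega) (by omega)).1 hmem
    omega

/-- **Lemma 5, case (i) of Lemma 4 with `|B₁|, |B₂| ≥ 2`** (p. 257, first half): `A = P ∖ {q}` an almost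
`d`-progression with an interior hole (`P` a run of `|A| + 1` terms, `q ± d ∈ A`), `B = B₁ ∪ B₂` two
disjoint `d`-runs of lengths `≥ 2`, `|A + B| = |A| + |B| ≤ p − 4`.  Then `A + B₁ = P + B₁` and
`A + B₂ = P + B₂` are runs of `|A| + |B₁|` and `|A| + |B₂|` terms whose union `A + B` has only
`|A| + |B|` elements, so they meet, `A + B` is a `d`-progression, and Lemma 3 gives `C(A, B)` (in print:
"otherwise `(A₁ + B₁) ∪ (A₂ + B₁) = A + B₁` would be a 1-progression").
[cite: HamidouneRodseth2000, §4 Lemma 5, case (i) (p. 257)] -/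
theorem common_of_hole_of_two_long_runs {A B : Finset (ZMod p)} {α d q b₁ b₂ : ZMod p} (hd : d ≠ 0)
    {m₁ m₂ : ℕ} (hins : insert q A = apFinset α d (#A + 1)) (hq1 : q - d ∈ A) (hq2 : q + d ∈ A)
    (hB : B = apFinset b₁ d m₁ ∪ apFinset b₂ d m₂) (hm₁ : 2 ≤ m₁) (hm₂ : 2 ≤ m₂) (hcardB : m₁ + m₂ = #B)
    (hAB : #(A + B) = #A + #B) (hp4 : #(A + B) + 4 ≤ p) :
    ∃ e a b : ZMod p, e ≠ 0 ∧ A ⊆ apFinset a e (#A + 1) ∧ B ⊆ apFinset b e (#B + 1) := by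
  have hA1 : 1 ≤ #A := card_pos.2 ⟨_, hq1⟩
  have hABu : A + B ≠ univ := ne_univ_of_card_lt (by omega)
  have hR : ∀ (b : ZMod p) (m : ℕ), 2 ≤ m → apFinset b d m ⊆ B →
      A + apFinset b d m = apFinset (α + b) d (#A + m) ∧ #(A + apFinset b d m) = #A + m := by
    intro b m hm hsub
    have hfill : A + apFinset b d m = apFinset α d (#A + 1) + apFinset b d m := by
      rw [← hins, insert_add_eq_add_of_neighbours hq1 hq2 (neighbour_mem_apFinset hm)]
    have hne : apFinset α d (#A + 1) + apFinset b d m ≠ univ := by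
      rw [← hfill]; exact fun h => hABu (eq_univ_of_subset (add_subset_add_left hsub) h)
    obtain ⟨heq, hcard⟩ := apFinset_add_apFinset_eq hd (by omega) (by omega) hne
    rw [hfill, hcard, heq, show #A + 1 + m - 1 = #A + m by omega]
    exact ⟨rfl, rfl⟩
  obtain ⟨hR₁, hc₁⟩ := hR b₁ m₁ hm₁ (by rw [hB]; exact subset_union_left)
  obtain ⟨hR₂, hc₂⟩ := hR b₂ m₂ hm₂ (by rw [hB]; exact subset_union_right)
  have hunion : A + B = (A + apFinset b₁ d m₁) ∪ (A + apFinset b₂ d m₂) := by rw [hB, add_union]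
  -- the two runs meet
  have hmeet : ((A + apFinset b₁ d m₁) ∩ (A + apFinset b₂ d m₂)).Nonempty := by
    rw [nonempty_iff_ne_empty]
    intro h
    have := card_union_of_disjoint (disjoint_iff_inter_eq_empty.2 h)
    rw [← hunion, hc₁, hc₂] at this
    omega
  rw [hR₁, hR₂] at hunion hmeet
  have h1 := card_vadd_sdiff_le_one_of_union_of_inter_nonempty hd hABu hunion hmeet
  have hAPd : IsAP (A + B) d := isAP_of_card_vadd_sdiff_le_one hd hABu h1
  obtain ⟨a, b, ha, hb⟩ := common_of_isAP_add hd (card_pos.1 hA1) (card_pos.1 (by omega)) hAPd hAB.le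
    (by omega)
  exact ⟨d, a, b, hd, ha, hb⟩

/-- **Lemma 5, case (i) of Lemma 4 with `|B₁| = 1`** (p. 257, second half): `A = P ∖ {q}` an almost
`d`-progression with an interior hole at index `i` (`A = A₁ ∪ A₂`, runs of `i` and `|A| − i` terms),
`B = {β} ∪ B₂` with `B₂` a `d`-run of `|B| − 1 ≥ 2` terms, `|A + B| = |A| + |B| ≤ p − 4`.  Then
`A + B = (β + A₁) ∪ (β + A₂) ∪ (P + B₂)` has at most three `d`-components; three are impossible
("`|A| + |B| = |A₁| + |A₂| + |A| + |B| − 1 ≥ |A| + |B| + 2`"), one gives `C(A,B)` by Lemma 3, and two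
give `|{0,d} + A + B| = |{0,d} + A| + |B| ≤ p − 2` with `{0,d} + A` a progression, so Lemma 1 makes `B`
an almost `d`-progression.
[cite: HamidouneRodseth2000, §4 Lemma 5, case (i) (p. 257)] -/
theorem common_of_hole_of_singleton_run {A B : Finset (ZMod p)} {α d q β b : ZMod p} (hd : d ≠ 0)
    {i m : ℕ} (hAP : A ⊆ apFinset α d (#A + 1)) (hins : insert q A = apFinset α d (#A + 1))
    (hq1 : q - d ∈ A) (hq2 : q + d ∈ A) (hq : α + i • d = q) (hi : i < #A + 1)
    (hB : B = {β} ∪ apFinset b d m) (hm : 2 ≤ m) (hcardB : m + 1 = #B)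
    (hAB : #(A + B) = #A + #B) (hp4 : #(A + B) + 4 ≤ p) :
    ∃ e a b : ZMod p, e ≠ 0 ∧ A ⊆ apFinset a e (#A + 1) ∧ B ⊆ apFinset b e (#B + 1) := by
  have hA1 : 1 ≤ #A := card_pos.2 ⟨_, hq1⟩
  have hBne : B.Nonempty := card_pos.1 (by omega)
  have hABu : A + B ≠ univ := ne_univ_of_card_lt (by omega)
  obtain ⟨hi1, hin⟩ := hole_index_bounds hd (n := #A) (by omega) hAP hq hi hq1 hq2
  have hqA : q ∉ A := by
    intro hq'
    have hc : #(insert q A) = #A := by rw [insert_eq_of_mem hq']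
    rw [hins, card_apFinset hd (by omega)] at hc
    omega
  have hAeq := eq_union_of_insert_eq_apFinset hd (n := #A) (by omega) hins hqA hq hi
  -- pieces of `A + B`
  set X₃ := A + apFinset b d m with hX₃
  have hfill : X₃ = apFinset α d (#A + 1) + apFinset b d m := by
    rw [hX₃, ← hins, insert_add_eq_add_of_neighbours hq1 hq2 (neighbour_mem_apFinset hm)]
  have hB₂B : apFinset b d m ⊆ B := by rw [hB]; exact subset_union_right
  have hX₃u : apFinset α d (#A + 1) + apFinset b d m ≠ univ := by
    rw [← hfill]; exact fun h => hABu (eq_univ_of_subset (add_subset_add_left hB₂B) h)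
  obtain ⟨hX₃eq, hX₃c⟩ := apFinset_add_apFinset_eq hd (by omega) (by omega) hX₃u
  rw [← hfill] at hX₃eq hX₃c
  have hunion : A + B = (β +ᵥ apFinset α d i) ∪ (β +ᵥ apFinset (α + (i + 1) • d) d (#A - i)) ∪ X₃ := by
    rw [hB, add_union, ← hX₃, add_singleton_eq_vadd, hAeq, vadd_finset_union, ← hAeq]
  rw [vadd_apFinset, vadd_apFinset] at hunion
  set X₁ := apFinset (β + α) d i with hX₁
  set X₂ := apFinset (β + (α + (i + 1) • d)) d (#A - i) with hX₂
  have hc₁ : #X₁ = i := card_apFinset hd (by omega)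
  have hc₂ : #X₂ = #A - i := card_apFinset hd (by omega)
  have hXu : ∀ Y : Finset (ZMod p), Y ⊆ A + B → Y ≠ univ := fun Y hY h => hABu (eq_univ_of_subset hY h)
  have hle3 : #((d +ᵥ (A + B)) \ (A + B)) ≤ 3 := by
    rw [hunion]
    refine (card_vadd_sdiff_union_three_le d X₁ X₂ X₃).trans ?_
    have h1 : #((d +ᵥ X₁) \ X₁) ≤ 1 := by
      rw [hX₁]; exact Isoperimetric.card_vadd_sdiff_apFinset_le_one _ d _
    have h2 : #((d +ᵥ X₂) \ X₂) ≤ 1 := by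
      rw [hX₂]; exact Isoperimetric.card_vadd_sdiff_apFinset_le_one _ d _
    have h3 : #((d +ᵥ X₃) \ X₃) ≤ 1 := by
      rw [hX₃eq]; exact Isoperimetric.card_vadd_sdiff_apFinset_le_one _ d _
    omega
  -- one component: Lemma 3
  by_cases hone : #((d +ᵥ (A + B)) \ (A + B)) ≤ 1
  · have hAPd : IsAP (A + B) d := isAP_of_card_vadd_sdiff_le_one hd hABu hone
    obtain ⟨a, b', ha, hb⟩ := common_of_isAP_add hd (card_pos.1 hA1) hBne hAPd hAB.le (by omega)
    exact ⟨d, a, b', hd, ha, hb⟩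
  by_cases hthree : #((d +ᵥ (A + B)) \ (A + B)) = 3
  · -- three components: the three runs are pairwise disjoint, too many elements
    exfalso
    have key : ∀ (Y Z W : Finset (ZMod p)) (y z : ZMod p) (k l : ℕ), Y = apFinset y d k → Z = apFinset z d l →
        A + B = Y ∪ Z ∪ W → #((d +ᵥ W) \ W) ≤ 1 → Disjoint Y Z := by
      intro Y Z W y z k l hY hZ hU hW
      rw [disjoint_iff_inter_eq_empty]
      by_contra hne
      have hYZu : Y ∪ Z ≠ univ := hXu _ (by rw [hU]; exact subset_union_left)
      have h1 := card_vadd_sdiff_le_one_of_union_of_inter_nonempty hd hYZu (by rw [hY, hZ])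
        (by rw [← hY, ← hZ]; exact nonempty_iff_ne_empty.2 hne)
      have := card_vadd_sdiff_union_le d (Y ∪ Z) W
      rw [← hU] at this
      omega
    have h3' : #((d +ᵥ X₃) \ X₃) ≤ 1 := by
      rw [hX₃eq]; exact Isoperimetric.card_vadd_sdiff_apFinset_le_one _ d _
    have d12 : Disjoint X₁ X₂ := key X₁ X₂ X₃ _ _ _ _ hX₁ hX₂ hunion h3'
    have h1' : #((d +ᵥ X₁) \ X₁) ≤ 1 := by
      rw [hX₁]; exact Isoperimetric.card_vadd_sdiff_apFinset_le_one _ d _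
    have h2' : #((d +ᵥ X₂) \ X₂) ≤ 1 := by
      rw [hX₂]; exact Isoperimetric.card_vadd_sdiff_apFinset_le_one _ d _
    have d13 : Disjoint X₁ X₃ := key X₁ X₃ X₂ _ _ _ _ hX₁ hX₃eq
      (by rw [hunion]; ext x; simp only [mem_union]; tauto) h2'
    have d23 : Disjoint X₂ X₃ := key X₂ X₃ X₁ _ _ _ _ hX₂ hX₃eq
      (by rw [hunion]; ext x; simp only [mem_union]; tauto) h1'
    have hcard : #(A + B) = #X₁ + #X₂ + #X₃ := by
      rw [hunion, card_union_of_disjoint (disjoint_union_left.2 ⟨d13, d23⟩), card_union_of_disjoint d12]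
    rw [hc₁, hc₂, hX₃c] at hcard
    omega
  -- two components: Lemma 1 for the progression `{0,d} + A`
  have htwo : #((d +ᵥ (A + B)) \ (A + B)) = 2 := by omega
  have hTA : A + ({0, d} : Finset (ZMod p)) = apFinset α d (#A + 2) := by
    rw [← insert_add_eq_add_of_neighbours hq1 hq2 (neighbour_mem_pair_zero d), hins,
      apFinset_add_pair_zero (by omega)]
  have hcTA : #(A + ({0, d} : Finset (ZMod p))) = #A + 2 := by rw [hTA]; exact card_apFinset hd (by omega)
  have hcTAB : #(B + (A + {0, d})) = #A + #B + 2 := by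
    rw [add_comm B, add_right_comm, Isoperimetric.card_add_pair_zero_eq, htwo, hAB]
  have hAPTA : IsAP (A + ({0, d} : Finset (ZMod p))) d := by rw [hTA]; exact isAP_apFinset hd (by omega)
  obtain ⟨b', hb'⟩ := Isoperimetric.subset_apFinset_of_isAP_of_card_add_le hd hAPTA (by omega) hBne
    (by omega) (by omega)
  exact ⟨d, α, b', hd, hAP, hb'⟩

/-- **Lemma 5 of Hamidoune–Rødseth, for `|A| ≥ 4`** (p. 256): "Let `|A|, |B| ≥ 3`, and suppose that
`7 ≤ |A + B| = |A| + |B| ≤ p − 4`.  Also assume that `A` is an almost-progression.  Then `A` and `B` are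
almost-progressions with the same difference."  Here for `|A| ≥ 4` and a general step `d ≠ 0`
(`A ⊆ {α, α + d, …, α + |A| d}`); the conclusion is `C(A, B)`.  Proof as printed: if `A` (resp. `B`) is a
`d`-progression, Lemma 1; otherwise `A` has an interior hole, Lemma 4 applies with (iii) excluded by
`|A| ≥ 4`, and case (i) is `common_of_hole_of_two_long_runs` / `common_of_hole_of_singleton_run`.
[cite: HamidouneRodseth2000, §4 Lemma 5 (pp. 256–257)] -/
theorem common_of_subset_apFinset {A B : Finset (ZMod p)} {d α : ZMod p} (hd : d ≠ 0) (hA4 : 4 ≤ #A)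
    (hB3 : 3 ≤ #B) (hAB : #(A + B) = #A + #B) (hp4 : #(A + B) + 4 ≤ p)
    (hAα : A ⊆ apFinset α d (#A + 1)) :
    ∃ e a b : ZMod p, e ≠ 0 ∧ A ⊆ apFinset a e (#A + 1) ∧ B ⊆ apFinset b e (#B + 1) := by
  have hAne : A.Nonempty := card_pos.1 (by omega)
  have hBne : B.Nonempty := card_pos.1 (by omega)
  have hABp : #(A + B) < p := by omega
  by_cases hAP : IsAP A d
  · obtain ⟨b, a, hb, ha⟩ := Isoperimetric.exists_common_apFinset_of_isAP hd hAP (by omega) hBne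
      (by rw [add_comm]; omega) (by rw [add_comm]; omega)
    exact ⟨d, a, b, hd, ha, hb⟩
  obtain ⟨q, hqA, hins, hq1, hq2⟩ := exists_interior_hole hd (n := #A) (by omega) (by omega) hAα rfl hAP
  have hqP : q ∈ apFinset α d (#A + 1) := by rw [← hins]; exact mem_insert_self q A
  obtain ⟨i, hi, hq⟩ := mem_apFinset.1 hqP
  obtain ⟨hi1, hin⟩ := hole_index_bounds hd (n := #A) (by omega) hAα hq hi hq1 hq2
  have hAeq := eq_union_of_insert_eq_apFinset hd (n := #A) (by omega) hins hqA hq hi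
  -- Lemma 4
  rcases runs_le_two_or_common_of_two_runs hd hAeq hi1 (by omega) (by omega) (by omega) hBne hAB hp4
    with hk | hC | ⟨h3, -⟩
  rotate_left
  · exact hC
  · omega
  -- (i): `B` is a double `d`-progression
  by_cases hk1 : #((d +ᵥ B) \ B) ≤ 1
  · have hBu : B ≠ univ := ne_univ_of_card_lt (by omega)
    have hBAP : IsAP B d := isAP_of_card_vadd_sdiff_le_one hd hBu hk1
    obtain ⟨a, b, ha, hb⟩ := Isoperimetric.exists_common_apFinset_of_isAP hd hBAP hB3 hAne hAB.le hABp
    exact ⟨d, a, b, hd, ha, hb⟩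
  have hk2 : #((d +ᵥ B) \ B) = 2 := by omega
  obtain ⟨b₁, b₂, m₁, m₂, hm₁, hm₂, hmsum, hBeq, -⟩ := exists_two_components hd hk2
  rcases (show (m₁ = 1 ∨ m₂ = 1) ∨ (2 ≤ m₁ ∧ 2 ≤ m₂) by omega) with hone | ⟨h2, h2'⟩
  · rcases hone with rfl | rfl
    · rw [apFinset_one] at hBeq
      exact common_of_hole_of_singleton_run hd hAα hins hq1 hq2 hq hi hBeq (by omega) (by omega) hAB hp4
    · rw [apFinset_one, union_comm] at hBeq
      exact common_of_hole_of_singleton_run hd hAα hins hq1 hq2 hq hi hBeq (by omega) (by omega) hAB hp4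
  · exact common_of_hole_of_two_long_runs hd hins hq1 hq2 hBeq h2 h2' hmsum hAB hp4

end HamidouneRodseth

end Literature.Combinatorics.Additive
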